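import Summits.QuantumFields.YangMills.Theorems.BalabanUVNodesN15KingModelFullPropagator

/-!
# BalabanUVNodes ∕ N15 — THE KING-MODEL RUNG, CURVED EDITION (PART O-b): THE TWO-SPACING η-RATE OF THE FULL `A = 0`
# FLUCTUATION PROPAGATOR `G^η_K` — `|G^{η′}_{K+n}(x′, y′) − G^η_K(x, y)| ≤ C·(L^{−γ∕2})^K·e^{−δ|B(x) − B(y)|}` off the diagonal,
# uniform in `K`, `n`, the volume and the mass, by the PAIRED induction on `K` (the peel of part O-a in both runs + part M's
# slice rate `ksSlice_rate_unif`; King's Prop. 3.8 (3.71) line 1 SHAPE for the full propagator of (2.13))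
# (Track A, DAG node N15 = NE2; FAN-OUT v1.1 §N15 s3 «KING-MODEL RUNG … + the one-line statement of what the curved case adds»)

HONEST FRAMING.  Count-neutral kernel bookkeeping (cell `pub-ymgap`, seat `pub-ymgap-dag-n15-e` g6; `--supports stmt-QuantumFields-19912
--as helper` = K3‴ `SpineGivenEndpointR13`, lineage K3 19676 → K3′ 19908).  TEMPLATE LITERATURE, `A = 0`: C. King's scalar U(1)-Higgs MODEL
on finite tori ([King1986] §2.2 p. 653 (2.13)–(2.17), p. 654 (2.20), Prop. 3.8 (3.71) p. 664 (the printed two-spacing statement is for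
`a_kG_kQ_k^*`, the minimiser — the full-propagator version below is its (2.17)-summed analogue, NOT a printed proposition), §4 p. 675
(4.42)–(4.43)), NOT Bałaban's covariant objects; NE2⁺ is NOT PRINTED for those and not proved here; NOT a node discharge; nothing
continuum ∕ ℝ⁴ ∕ OS ∕ mass-gap ∕ Clay.  0 `sorry`, 0 `def`, standard axioms.

THE POINT.  Part O-a (`…N15KingModelFullPropagator`) proved the `K`-uniform off-diagonal decay of King's full `A = 0` fluctuation
propagator `G(K, M, m²) = constrainedProp (L^K) M (aK a L K) ((L^K)²) m²` by peeling (2.17) one level at a time.  THIS FILE runs the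
same induction on the PAIR (fine run with `L^nL^K` points per unit block, coarse run with `L^K`; King's pairing `x′ ↦ x` = part C's
`underPtN`) and proves the two-spacing η-rate of the FULL propagator:
* §1 `fine_assoc`, **`underPtN_flatten`** — King's pairing commutes with the peel:
  `underPtN (K+1) n M (e(flatten x′)) = flatten (underPtN K n (fine L M) x′)` (labels: `⌊x′_μ∕L^n⌋` either way);
* §2 **`fullProp_peel_fine`** ∕ `fullProp_peel_fine'` — the peel of the FINE run (`constrainedProp_succ_flatten` at `N = L^nL^K`,
  `k = K + n`, + part K `ksSlice'_eq_sub`, + `TorusCongr.constrainedProp_congrN` for the spelling `(L^nL^K)·L = L^n·L^{K+1}`):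
  `G(K+1+n)(e(flatten x′), e(flatten y′)) = L^{d+1}∕L²·[G(K+n, fine L M_e, m²∕L²)(x′, y′) + ksSlice′ (m²∕L²) i (x′, y′)]`;
  `fullProp_peel_pair_abs_le` (the difference of the two peels);
* §3 **`fullProp_rate_unif`** — `∃ C δ > 0, D₀ ≥ 1` (functions of `d, L, a, m₀², γ`; `0 ≤ γ ≤ 1`) such that for EVERY `K ≥ 1`, `n ≥ 1`,
  cube `M_μ = 2L^e`, mass `0 < m² ≤ m₀²` and fine points `x′, y′` over `x, y` with `|B(x) − B(y)|_M ≥ D₀`: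
  `|G(K+n, M, m²)(x′, y′) − G(K, M, m²)(x, y)| ≤ C·(L^{−γ∕2})^K·e^{−δ|B(x) − B(y)|_M}`.
  PAIRED INDUCTION ON `K`: base `K = 1` = part O-a's decay for BOTH runs (`G(1+n)` is an `(1+n)`-level propagator — O-a is uniform in
  the number of levels, spelling `N = L^n·L^1`) with `2C₁ ≤ (2C₁L)·L^{−γ∕2}`; step = subtract the two peels (§2 and part O-a §2 at the
  SAME index `i = (e, K, n)` and mass `m²∕L²`), the induction hypothesis on the finer cube for the sub-pair, part M `ksSlice_rate_unif`
  for the slice pair, both at the finer block distance `D_sub ≥ L(D − 1) + 1`, and the gain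
  `(2L^{d+1}∕L)·e^{−δ(L−1)(D−1)} ≤ (2L^{d+1}∕L)·e^{−2L^{d+1}∕L} ≤ 1` times the spare `L⁻¹ ≤ L^{−γ∕2}` for the extra power of the rate.
WHAT THE CURVED CASE ADDS (one line): Bałaban's `G_k(U)` ([B9] (3.35)–(3.36)) — the same two inequalities for the covariant propagator,
uniformly over the live window `Reg335`; print gives analyticity in `U` and η-uniformity (Thm 3.4), never an η-difference.
HONEST SCOPE.  (i) `A = 0`, periodic b.c., odd `L ≥ 3`, `0 < m² ≤ m₀²`, cubes `2L^e`; (ii) lattice units of the level-`K` lattice (parts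
F–O-a); (iii) OFF-DIAGONAL (`|B(x) − B(y)| ≥ D₀`; on the diagonal the statement is false uniformly in `K`, as for O-a); (iv) `K, n ≥ 1`;
(v) the rate exponent `γ∕2` and the decay rate are inherited from part M (immaterial for the shape); (vi) not Bałaban's `G_k(U)`; not a discharge.
Locators: [King1986] C. King, CMP **102** (1986) 649–677: (2.13)–(2.17) p. 653, (2.20) p. 654, Prop. 3.8 (3.71) p. 664 (shape; and p. 664
«When x′ ∈ T_{η′}, we denote by x that point in T_η for which x′ ∈ B^n(x)»), (4.42)–(4.43) p. 675; [B9] = [Balaban1985BackgroundPropagators]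
Thm 3.14 pp. 426–427 (typing template of NE2's difference family).
-/

noncomputable section

namespace Summit.QuantumFields.YangMills.BalabanUVNodes.N15KingModelRung.Curved

open Real Finset Matrix
open Literature.MathematicalPhysics.QuantumFieldTheory.Balaban1983to89.B5Prop11Plancherel (Tor fine)
open Literature.MathematicalPhysics.QuantumFieldTheory.King1986 (aK aK_pos)
open Literature.MathematicalPhysics.QuantumFieldTheory.King1986.Torus (constrainedProp flatten blockOf tdistT torCongr
  val_torCongr val_flatten blockOf_flatten constrainedProp_succ_flatten constrainedProp_congrN tdistT_nonneg)

variable {d : ℕ} (L : ℕ) [NeZero L]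

/-! ## §1 King's pairing commutes with the peel -/

omit [NeZero L] in
/-- `L^n·L^K·L = L^n·L^{K+1}` coordinatewise for the fine periods (the spelling bridge of the fine run's peel). [cite: King1986, (2.10) p.653, (2.20) p.654] -/
theorem fine_assoc (K n : ℕ) (M : Fin (d + 1) → ℕ) :
    ∀ μ, fine (L ^ n * L ^ K * L) M μ = fine (L ^ n * L ^ (K + 1)) M μ :=
  fun μ => by
    show L ^ n * L ^ K * L * M μ = L ^ n * L ^ (K + 1) * M μ
    rw [pow_succ]
    ring

/-- **King's pairing `x′ ↦ x` commutes with the peel**: reading a fine point of the `(K+1)`-level run through the re-indexings of the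
nested torus, `underPtN (K+1) n M (e(flatten x′)) = flatten (underPtN K n (fine L M) x′)` — both have labels `⌊x′_μ∕L^n⌋`.
[cite: King1986, p.664 (the pairing `x′ ∈ B^n(x)`), (2.10) p.653] -/
theorem underPtN_flatten (K n : ℕ) (M : Fin (d + 1) → ℕ) [∀ μ, NeZero (M μ)]
    (h : ∀ μ, fine (L ^ n * L ^ K * L) M μ = fine (L ^ n * L ^ (K + 1)) M μ)
    (z' : Tor (fine (L ^ n * L ^ K) (fine L M))) :
    underPtN L (K + 1) n M (torCongr h (flatten (L ^ n * L ^ K) L M z'))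
      = flatten (L ^ K) L M (underPtN L K n (fine L M) z') := by
  funext μ
  apply ZMod.val_injective
  rw [val_underPtN, val_torCongr, val_flatten]
  erw [val_flatten, val_underPtN]

/-! ## §2 The peel of the fine run -/

/-- **THE PEEL OF THE FINE RUN**: for the slice index `i = (e, K = i.j, n = i.n, …)`, `a > 0`, `m² > 0`, `L ≥ 2`, fine points `x′, y′` of the
nested torus `Tor (fine (L^nL^K) (fine L M_e))` and the spelling bridge `h`, the `(K+1+n)`-level propagator over the cube `M_e` at mass `L²m²`
read at the re-indexed points is `L^{d+1}∕L²` times [the `(K+n)`-level propagator over the finer cube `fine L M_e` at mass `m²` + the fine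
top slice `ksSlice′ m² i`]. (`constrainedProp_congrN` + `constrainedProp_succ_flatten` + `ksSlice'_eq_sub`.) [cite: King1986, (2.13)–(2.17) p.653, (2.20) p.654, (4.42) p.675] -/
theorem fullProp_peel_fine (hL : 2 ≤ L) {a m2 : ℝ} (ha : 0 < a) (hm : 0 < m2) (i : KSliceIdx d)
    (x' y' : Tor (fine (L ^ i.n * L ^ i.j) (ksU L i)))
    (h : ∀ μ, fine (L ^ i.n * L ^ i.j * L) (ksM L i) μ = fine (L ^ i.n * L ^ (i.j + 1)) (ksM L i) μ) :
    constrainedProp (L ^ i.n * L ^ (i.j + 1)) (ksM L i) (aK a L (i.j + 1 + i.n))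
        (((L ^ i.n * L ^ (i.j + 1) : ℕ) : ℝ) ^ 2) ((L : ℝ) ^ 2 * m2)
        (torCongr h (flatten (L ^ i.n * L ^ i.j) L (ksM L i) x')) (torCongr h (flatten (L ^ i.n * L ^ i.j) L (ksM L i) y'))
      = (L : ℝ) ^ (d + 1) / (L : ℝ) ^ 2 *
          (constrainedProp (L ^ i.n * L ^ i.j) (ksU L i) (aK a L (i.j + i.n)) (((L ^ i.n * L ^ i.j : ℕ) : ℝ) ^ 2) m2 x' y'
            + ksSlice' L a m2 i x' y') := by
  have hN : L ^ i.n * L ^ i.j * L = L ^ i.n * L ^ (i.j + 1) := by rw [pow_succ, mul_assoc]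
  have h1 := constrainedProp_congrN (L ^ i.n * L ^ i.j * L) hN (ksM L i) (aK a L (i.j + 1 + i.n))
    (((L ^ i.n * L ^ (i.j + 1) : ℕ) : ℝ) ^ 2) ((L : ℝ) ^ 2 * m2)
    (flatten (L ^ i.n * L ^ i.j) L (ksM L i) x') (flatten (L ^ i.n * L ^ i.j) L (ksM L i) y')
  rw [h1]
  have hcast : ((L ^ i.n * L ^ (i.j + 1) : ℕ) : ℝ) = ((L ^ i.n * L ^ i.j * L : ℕ) : ℝ) := by rw [hN]
  have hjn : i.j + 1 + i.n = i.j + i.n + 1 := by omega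
  rw [hcast, hjn, constrainedProp_succ_flatten (L ^ i.n * L ^ i.j) L (ksM L i) ha hL (k := i.j + i.n)
      (by have := i.one_le_j; omega) hm x' y', ksSlice'_eq_sub L hL ha hm i x' y']
  ring

/-- **The fine peel with the mass on the left arbitrary**: the sub-propagator and the fine slice carry `m²∕L²`. [cite: King1986, (2.17) p.653, (2.20) p.654] -/
theorem fullProp_peel_fine' (hL : 2 ≤ L) {a msq : ℝ} (ha : 0 < a) (hm : 0 < msq) (i : KSliceIdx d)
    (x' y' : Tor (fine (L ^ i.n * L ^ i.j) (ksU L i)))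
    (h : ∀ μ, fine (L ^ i.n * L ^ i.j * L) (ksM L i) μ = fine (L ^ i.n * L ^ (i.j + 1)) (ksM L i) μ) :
    constrainedProp (L ^ i.n * L ^ (i.j + 1)) (ksM L i) (aK a L (i.j + 1 + i.n))
        (((L ^ i.n * L ^ (i.j + 1) : ℕ) : ℝ) ^ 2) msq
        (torCongr h (flatten (L ^ i.n * L ^ i.j) L (ksM L i) x')) (torCongr h (flatten (L ^ i.n * L ^ i.j) L (ksM L i) y'))
      = (L : ℝ) ^ (d + 1) / (L : ℝ) ^ 2 *
          (constrainedProp (L ^ i.n * L ^ i.j) (ksU L i) (aK a L (i.j + i.n)) (((L ^ i.n * L ^ i.j : ℕ) : ℝ) ^ 2)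
              (msq / (L : ℝ) ^ 2) x' y'
            + ksSlice' L a (msq / (L : ℝ) ^ 2) i x' y') := by
  have hL0 : (0 : ℝ) < L := by exact_mod_cast (show 0 < L by omega)
  have hL2 : (L : ℝ) ^ 2 ≠ 0 := pow_ne_zero _ hL0.ne'
  have h1 := fullProp_peel_fine L hL ha (m2 := msq / (L : ℝ) ^ 2) (by positivity) i x' y' h
  rw [mul_div_cancel₀ msq hL2] at h1
  exact h1

/-- **The difference of the two peels, triangle-inequality form**: at the same index and mass,
`|G(K+1+n)(e x̂′, e ŷ′) − G(K+1)(x̂, ŷ)| ≤ L^{d+1}∕L²·(|G(K+n)^{sub}(x′, y′) − G(K)^{sub}(x, y)| + |ksSlice′(x′, y′) − ksSlice(x, y)|)`.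
[cite: King1986, (2.17) p.653, (4.42)–(4.43) p.675] -/
theorem fullProp_peel_pair_abs_le (hL : 2 ≤ L) {a msq : ℝ} (ha : 0 < a) (hm : 0 < msq) (i : KSliceIdx d)
    (x' y' : Tor (fine (L ^ i.n * L ^ i.j) (ksU L i))) (x y : Tor (fine (L ^ i.j) (ksU L i)))
    (h : ∀ μ, fine (L ^ i.n * L ^ i.j * L) (ksM L i) μ = fine (L ^ i.n * L ^ (i.j + 1)) (ksM L i) μ) :
    |constrainedProp (L ^ i.n * L ^ (i.j + 1)) (ksM L i) (aK a L (i.j + 1 + i.n))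
          (((L ^ i.n * L ^ (i.j + 1) : ℕ) : ℝ) ^ 2) msq
          (torCongr h (flatten (L ^ i.n * L ^ i.j) L (ksM L i) x')) (torCongr h (flatten (L ^ i.n * L ^ i.j) L (ksM L i) y'))
        - constrainedProp (L ^ i.j * L) (ksM L i) (aK a L (i.j + 1)) (((L ^ i.j * L : ℕ) : ℝ) ^ 2) msq
          (flatten (L ^ i.j) L (ksM L i) x) (flatten (L ^ i.j) L (ksM L i) y)|
      ≤ (L : ℝ) ^ (d + 1) / (L : ℝ) ^ 2 *
          (|constrainedProp (L ^ i.n * L ^ i.j) (ksU L i) (aK a L (i.j + i.n)) (((L ^ i.n * L ^ i.j : ℕ) : ℝ) ^ 2)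
                (msq / (L : ℝ) ^ 2) x' y'
              - constrainedProp (L ^ i.j) (ksU L i) (aK a L i.j) (((L ^ i.j : ℕ) : ℝ) ^ 2) (msq / (L : ℝ) ^ 2) x y|
            + |ksSlice' L a (msq / (L : ℝ) ^ 2) i x' y' - ksSlice L a (msq / (L : ℝ) ^ 2) i x y|) := by
  have hΛ : 0 ≤ (L : ℝ) ^ (d + 1) / (L : ℝ) ^ 2 := by positivity
  rw [fullProp_peel_fine' L hL ha hm i x' y' h, fullProp_peel' L hL ha hm i x y, ← mul_sub, abs_mul, abs_of_nonneg hΛ]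
  refine mul_le_mul_of_nonneg_left ?_ hΛ
  have e : ∀ (p q r s : ℝ), p + q - (r + s) = (p - r) + (q - s) := fun p q r s => by ring
  rw [e]
  exact abs_add_le _ _

/-! ## §3 The two-spacing η-rate of the full propagator -/

/-- **THE TWO-SPACING η-RATE OF KING'S FULL `A = 0` FLUCTUATION PROPAGATOR** (Prop. 3.8 (3.71) line 1 SHAPE for the covariance of
(2.13); the (2.17)-summed analogue of the printed minimiser statement): for odd `L ≥ 3`, `a > 0`, a mass cap `m₀² ≥ 0` and `0 ≤ γ ≤ 1`
there are `C, δ > 0` and `D₀ ≥ 1` (functions of `d, L, a, m₀², γ`) such that for EVERY `K ≥ 1`, `n ≥ 1`, cube `M_μ = 2L^e`, mass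
`0 < m² ≤ m₀²` and all fine points `x′, y′` of the `(K+n)`-level run over `x, y` (King's pairing `underPtN`) with `|B(x) − B(y)|_M ≥ D₀`:
`|G^{η′}_{K+n}(x′, y′) − G^η_K(x, y)| ≤ C·(L^{−γ∕2})^K·e^{−δ·|B(x) − B(y)|_M}`, both propagators King's `constrainedProp` at the same
mass in their level-`K` ∕ level-`(K+n)` lattice units.  Paired induction on `K` (module docstring). [cite: King1986, (2.13)–(2.17) p.653, (2.20) p.654, Prop. 3.8 (3.71) p.664, (4.42)–(4.43) p.675] -/
theorem fullProp_rate_unif (hLodd : Odd L) (hL : 2 ≤ L) {a : ℝ} (ha : 0 < a) {m0sq : ℝ} (hm0 : 0 ≤ m0sq) {γ : ℝ}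
    (hγ0 : 0 ≤ γ) (hγ1 : γ ≤ 1) :
    ∃ C δ D₀ : ℝ, 0 < C ∧ 0 < δ ∧ 1 ≤ D₀ ∧ ∀ (K : ℕ), 1 ≤ K → ∀ (n : ℕ), 1 ≤ n →
      ∀ (e : ℕ) (M : Fin (d + 1) → ℕ) [∀ μ, NeZero (M μ)], (∀ μ, M μ = 2 * L ^ e) →
      ∀ (msq : ℝ), 0 < msq → msq ≤ m0sq →
      ∀ x' y' : Tor (fine (L ^ n * L ^ K) M),
        D₀ ≤ tdistT M (blockOf (L ^ K) M (underPtN L K n M x')) (blockOf (L ^ K) M (underPtN L K n M y')) →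
        |constrainedProp (L ^ n * L ^ K) M (aK a L (K + n)) (((L ^ n * L ^ K : ℕ) : ℝ) ^ 2) msq x' y'
            - constrainedProp (L ^ K) M (aK a L K) (((L ^ K : ℕ) : ℝ) ^ 2) msq
                (underPtN L K n M x') (underPtN L K n M y')|
          ≤ C * (((L : ℝ) ^ (-(γ / 2))) ^ K)
              * Real.exp (-(δ * tdistT M (blockOf (L ^ K) M (underPtN L K n M x'))
                  (blockOf (L ^ K) M (underPtN L K n M y')))) := by
  have hL1 : 1 < L := by omega
  have hL1' : (1 : ℝ) ≤ L := by exact_mod_cast hL1.le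
  have hL0 : (0 : ℝ) < L := by positivity
  have hLm1 : (1 : ℝ) ≤ (L : ℝ) - 1 := by
    have : (2 : ℝ) ≤ L := by exact_mod_cast hL
    linarith
  -- the rate `θ = L^{−γ∕2} ∈ [L⁻¹, 1]`
  set θ : ℝ := (L : ℝ) ^ (-(γ / 2)) with hθdef
  have hθ0 : 0 < θ := Real.rpow_pos_of_pos hL0 _
  have hθL : (L : ℝ)⁻¹ ≤ θ := by
    rw [hθdef, ← Real.rpow_neg_one]
    exact Real.rpow_le_rpow_of_exponent_le hL1' (by linarith)
  -- part O-a (both runs at the base) and part M's slice rate (the step)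
  obtain ⟨C₁, δ₁, D₁, hC₁, hδ₁, hD₁, H₁⟩ := fullProp_decay_unif (d := d) L hLodd hL ha hm0
  obtain ⟨Cr, κ, hCr, hκ, Hr⟩ := ksSlice_rate_unif (d := d) L hLodd hL ha hm0 hγ0 hγ1
  -- the constants of the theorem
  set Λ : ℝ := (L : ℝ) ^ (d + 1) / (L : ℝ) ^ 2 with hΛdef
  have hΛ : 0 < Λ := by positivity
  set δ : ℝ := min δ₁ κ with hδdef
  have hδ : 0 < δ := lt_min hδ₁ hκ
  have hδ1' : δ ≤ δ₁ := min_le_left _ _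
  have hδκ : δ ≤ κ := min_le_right _ _
  set C : ℝ := max (2 * C₁ * L) Cr with hCdef
  have hC : 0 < C := lt_max_of_lt_right hCr
  have hC1C : 2 * C₁ * L ≤ C := le_max_left _ _
  have hCrC : Cr ≤ C := le_max_right _ _
  set A : ℝ := 2 * Λ * L with hAdef
  have hA : 0 < A := by positivity
  set D₀ : ℝ := max D₁ (1 + A / (δ * ((L : ℝ) - 1))) with hD₀def
  have hD₀1 : 1 ≤ D₀ := hD₁.trans (le_max_left _ _)
  have hD₀D₁ : D₁ ≤ D₀ := le_max_left _ _
  have hD₀A : 1 + A / (δ * ((L : ℝ) - 1)) ≤ D₀ := le_max_right _ _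
  refine ⟨C, δ, D₀, hC, hδ, hD₀1, ?_⟩
  intro K hK
  induction K, hK using Nat.le_induction with
  | base =>
    -- `K = 1`: both runs are bounded by part O-a (uniform in the number of levels)
    intro n hn e M _ hM msq hmsq hcap x' y' hD
    set u := underPtN L 1 n M x' with hu
    set v := underPtN L 1 n M y' with hv
    set D : ℝ := tdistT M (blockOf (L ^ 1) M u) (blockOf (L ^ 1) M v) with hDdef
    have hDD₁ : D₁ ≤ D := hD₀D₁.trans hD
    have hD0 : 0 ≤ D := tdistT_nonneg _ _ _
    -- the fine run: an `(1+n)`-level propagator, spelling `N = L^n·L^1`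
    have hfine := H₁ (1 + n) (by omega) (L ^ n * L ^ 1) (by rw [pow_add, mul_comm]) e M hM msq hmsq hcap x' y'
      (by rwa [← blockOf_underPtN L 1 n M x', ← blockOf_underPtN L 1 n M y'])
    rw [← blockOf_underPtN L 1 n M x', ← blockOf_underPtN L 1 n M y'] at hfine
    -- the coarse run
    have hcoarse := H₁ 1 le_rfl (L ^ 1) rfl e M hM msq hmsq hcap u v hDD₁
    have hexp : Real.exp (-(δ₁ * D)) ≤ Real.exp (-(δ * D)) :=
      Real.exp_le_exp.mpr (neg_le_neg (mul_le_mul_of_nonneg_right hδ1' hD0))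
    have hθ1 : 2 * C₁ ≤ C * θ ^ 1 := by
      rw [pow_one]
      calc 2 * C₁ = 2 * C₁ * L * (L : ℝ)⁻¹ := by field_simp
        _ ≤ C * θ := mul_le_mul hC1C hθL (inv_pos.mpr hL0).le hC.le
    calc |constrainedProp (L ^ n * L ^ 1) M (aK a L (1 + n)) (((L ^ n * L ^ 1 : ℕ) : ℝ) ^ 2) msq x' y'
            - constrainedProp (L ^ 1) M (aK a L 1) (((L ^ 1 : ℕ) : ℝ) ^ 2) msq u v|
        ≤ |constrainedProp (L ^ n * L ^ 1) M (aK a L (1 + n)) (((L ^ n * L ^ 1 : ℕ) : ℝ) ^ 2) msq x' y'|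
            + |constrainedProp (L ^ 1) M (aK a L 1) (((L ^ 1 : ℕ) : ℝ) ^ 2) msq u v| := abs_sub _ _
      _ ≤ C₁ * Real.exp (-(δ₁ * D)) + C₁ * Real.exp (-(δ₁ * D)) := add_le_add hfine hcoarse
      _ = 2 * C₁ * Real.exp (-(δ₁ * D)) := by ring
      _ ≤ C * θ ^ 1 * Real.exp (-(δ * D)) := mul_le_mul hθ1 hexp (Real.exp_pos _).le (by positivity)
  | succ K hK IH =>
    intro n hn e M _ hM msq hmsq hcap x'' y'' hD
    -- the unit lattice IS the cube `M_e`
    obtain rfl : M = fun _ => 2 * L ^ e := funext hM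
    -- the slice index of the peeled top slices and the nested coordinates of the fine points
    set i : KSliceIdx d := ⟨e, K, hK, n, hn, 0, Nat.zero_le e, 1, le_rfl⟩ with hidef
    have h : ∀ μ, fine (L ^ n * L ^ K * L) (ksM L i) μ = fine (L ^ n * L ^ (K + 1)) (ksM L i) μ :=
      fine_assoc L K n (ksM L i)
    obtain ⟨x', rfl⟩ := ((flatten (L ^ n * L ^ K) L (ksM L i)).trans (torCongr h)).surjective x''
    obtain ⟨y', rfl⟩ := ((flatten (L ^ n * L ^ K) L (ksM L i)).trans (torCongr h)).surjective y''
    simp only [Equiv.trans_apply] at hD ⊢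
    rw [underPtN_flatten L K n (ksM L i) h x', underPtN_flatten L K n (ksM L i) h y'] at hD ⊢
    -- the coarse points under `x′, y′` in the finer cube
    set x := underPtN L K n (ksU L i) x' with hxdef
    set y := underPtN L K n (ksU L i) y' with hydef
    -- the two block distances
    set D : ℝ := tdistT (fun _ : Fin (d + 1) => 2 * L ^ e)
        (blockOf (L ^ (K + 1)) (fun _ : Fin (d + 1) => 2 * L ^ e) (flatten (L ^ K) L (ksM L i) x))
        (blockOf (L ^ (K + 1)) (fun _ : Fin (d + 1) => 2 * L ^ e) (flatten (L ^ K) L (ksM L i) y)) with hDdef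
    set Dsub : ℝ := tdistT (ksU L i) (blockOf (L ^ K) (ksU L i) x) (blockOf (L ^ K) (ksU L i) y) with hDsubdef
    have hBx : blockOf (L ^ (K + 1)) (fun _ : Fin (d + 1) => 2 * L ^ e) (flatten (L ^ K) L (ksM L i) x)
        = blockOf L (ksM L i) (blockOf (L ^ K) (ksU L i) x) := blockOf_flatten (L ^ K) L (ksM L i) x
    have hBy : blockOf (L ^ (K + 1)) (fun _ : Fin (d + 1) => 2 * L ^ e) (flatten (L ^ K) L (ksM L i) y)
        = blockOf L (ksM L i) (blockOf (L ^ K) (ksU L i) y) := blockOf_flatten (L ^ K) L (ksM L i) y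
    have hgrow : (L : ℝ) * D ≤ Dsub + ((L : ℝ) - 1) := by
      rw [hDdef, hBx, hBy]
      exact mul_tdistT_blockOf_le L (ksM L i) (blockOf (L ^ K) (ksU L i) x) (blockOf (L ^ K) (ksU L i) y)
    have hD₀D : D₀ ≤ D := hD
    have hD1 : 1 ≤ D := hD₀1.trans hD₀D
    have hDsub_ge : (L : ℝ) * (D - 1) + 1 ≤ Dsub := by linarith
    have hprod : 0 ≤ ((L : ℝ) - 1) * (D - 1) := mul_nonneg (by linarith) (by linarith)
    have hDsub_D₀ : D₀ ≤ Dsub := by linarith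
    have hDsub0 : 0 ≤ Dsub := tdistT_nonneg _ _ _
    -- the mass one level down
    have hL2 : (0 : ℝ) < (L : ℝ) ^ 2 := by positivity
    have hm2 : 0 < msq / (L : ℝ) ^ 2 := div_pos hmsq hL2
    have hm2cap : msq / (L : ℝ) ^ 2 ≤ m0sq := by
      have h1 : (1 : ℝ) ≤ (L : ℝ) ^ 2 := one_le_pow₀ hL1'
      exact (div_le_self hmsq.le h1).trans hcap
    -- the induction hypothesis on the finer cube `fine L M_e = (2L^{e+1})` for the sub-pair
    have hM' : ∀ μ, ksU L i μ = 2 * L ^ (e + 1) := fun μ => by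
      show L * (2 * L ^ e) = 2 * L ^ (e + 1)
      ring
    have hIH : |constrainedProp (L ^ n * L ^ K) (ksU L i) (aK a L (K + n)) (((L ^ n * L ^ K : ℕ) : ℝ) ^ 2)
            (msq / (L : ℝ) ^ 2) x' y'
          - constrainedProp (L ^ K) (ksU L i) (aK a L K) (((L ^ K : ℕ) : ℝ) ^ 2) (msq / (L : ℝ) ^ 2) x y|
        ≤ C * θ ^ K * Real.exp (-(δ * Dsub)) :=
      IH n hn (e + 1) (ksU L i) hM' (msq / (L : ℝ) ^ 2) hm2 hm2cap x' y' hDsub_D₀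
    -- part M's slice rate at the finer block distance
    have hS : |ksSlice' L a (msq / (L : ℝ) ^ 2) i x' y' - ksSlice L a (msq / (L : ℝ) ^ 2) i x y|
        ≤ Cr * θ ^ K * Real.exp (-(κ * Dsub)) := Hr (msq / (L : ℝ) ^ 2) hm2 hm2cap i x' y'
    have hS' : |ksSlice' L a (msq / (L : ℝ) ^ 2) i x' y' - ksSlice L a (msq / (L : ℝ) ^ 2) i x y|
        ≤ C * θ ^ K * Real.exp (-(δ * Dsub)) :=
      hS.trans (mul_le_mul (mul_le_mul_of_nonneg_right hCrC (pow_nonneg hθ0.le K))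
        (Real.exp_le_exp.mpr (neg_le_neg (mul_le_mul_of_nonneg_right hδκ hDsub0))) (Real.exp_pos _).le
        (by positivity))
    -- the pair of peels
    have hpeel := fullProp_peel_pair_abs_le L hL ha hmsq i x' y' x y h
    -- the gain: `(A∕L)·C·θ^K·e^{−δ·Dsub} ≤ C·θ^{K+1}·e^{−δ·D}`
    have hgainD : A ≤ δ * (((L : ℝ) - 1) * (D - 1)) := by
      have h1 : A / (δ * ((L : ℝ) - 1)) ≤ D - 1 := by linarith
      have h2 : 0 < δ * ((L : ℝ) - 1) := by positivity
      calc A ≤ (D - 1) * (δ * ((L : ℝ) - 1)) := (div_le_iff₀ h2).mp h1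
        _ = δ * (((L : ℝ) - 1) * (D - 1)) := by ring
    have hexp : Real.exp (-(δ * Dsub)) ≤ Real.exp (-(δ * D)) * Real.exp (-A) := by
      rw [← Real.exp_add]
      apply Real.exp_le_exp.mpr
      have h1 : δ * ((L : ℝ) * (D - 1) + 1) ≤ δ * Dsub := mul_le_mul_of_nonneg_left hDsub_ge hδ.le
      have h2 : δ * ((L : ℝ) * (D - 1) + 1) = δ * (((L : ℝ) - 1) * (D - 1)) + δ * D := by ring
      linarith
    have hAexp : A * Real.exp (-A) ≤ 1 := by
      have h1 : A ≤ Real.exp A := by linarith [Real.add_one_le_exp A]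
      rw [Real.exp_neg, ← div_eq_mul_inv, div_le_one (Real.exp_pos A)]
      exact h1
    have hgain : 2 * Λ * (C * θ ^ K * Real.exp (-(δ * Dsub))) ≤ C * θ ^ (K + 1) * Real.exp (-(δ * D)) := by
      have hAL : 2 * Λ = A * (L : ℝ)⁻¹ := by rw [hAdef]; field_simp
      calc 2 * Λ * (C * θ ^ K * Real.exp (-(δ * Dsub)))
          ≤ 2 * Λ * (C * θ ^ K * (Real.exp (-(δ * D)) * Real.exp (-A))) :=
            mul_le_mul_of_nonneg_left (mul_le_mul_of_nonneg_left hexp (by positivity)) (by positivity)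
        _ = (A * Real.exp (-A)) * (L : ℝ)⁻¹ * (C * θ ^ K * Real.exp (-(δ * D))) := by rw [hAL]; ring
        _ ≤ 1 * θ * (C * θ ^ K * Real.exp (-(δ * D))) :=
            mul_le_mul_of_nonneg_right (mul_le_mul hAexp hθL (inv_pos.mpr hL0).le zero_le_one) (by positivity)
        _ = C * θ ^ (K + 1) * Real.exp (-(δ * D)) := by rw [pow_succ]; ring
    -- assemble (the goal's `K + 1 + n` is the peel's `i.j + 1 + i.n`)
    calc |constrainedProp (L ^ n * L ^ (K + 1)) (fun _ : Fin (d + 1) => 2 * L ^ e) (aK a L (K + 1 + n))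
              (((L ^ n * L ^ (K + 1) : ℕ) : ℝ) ^ 2) msq
              (torCongr h (flatten (L ^ n * L ^ K) L (ksM L i) x')) (torCongr h (flatten (L ^ n * L ^ K) L (ksM L i) y'))
            - constrainedProp (L ^ (K + 1)) (fun _ : Fin (d + 1) => 2 * L ^ e) (aK a L (K + 1))
              (((L ^ (K + 1) : ℕ) : ℝ) ^ 2) msq (flatten (L ^ K) L (ksM L i) x) (flatten (L ^ K) L (ksM L i) y)|
        ≤ Λ * (|constrainedProp (L ^ n * L ^ K) (ksU L i) (aK a L (K + n)) (((L ^ n * L ^ K : ℕ) : ℝ) ^ 2)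
                  (msq / (L : ℝ) ^ 2) x' y'
                - constrainedProp (L ^ K) (ksU L i) (aK a L K) (((L ^ K : ℕ) : ℝ) ^ 2) (msq / (L : ℝ) ^ 2) x y|
              + |ksSlice' L a (msq / (L : ℝ) ^ 2) i x' y' - ksSlice L a (msq / (L : ℝ) ^ 2) i x y|) := hpeel
      _ ≤ Λ * (C * θ ^ K * Real.exp (-(δ * Dsub)) + C * θ ^ K * Real.exp (-(δ * Dsub))) :=
          mul_le_mul_of_nonneg_left (add_le_add hIH hS') hΛ.le
      _ = 2 * Λ * (C * θ ^ K * Real.exp (-(δ * Dsub))) := by ring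
      _ ≤ C * θ ^ (K + 1) * Real.exp (-(δ * D)) := hgain

end Summit.QuantumFields.YangMills.BalabanUVNodes.N15KingModelRung.Curved
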